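import Literature.AlgebraicGeometry.AbelianSchemes.AbelianSchemeKOfLSeesaw
import Literature.AlgebraicGeometry.AbelianSchemes.AbelianSchemeKOfLFibres
import Literature.AlgebraicGeometry.Morphisms.FiniteOfFiniteGeometricFibres
import Literature.AlgebraicGeometry.AbelianSchemes.AbelianSchemeOverGeometricallyIntegral
import HarnessLib

/-!
# `K(L)` is finite over the base: the representing closed subscheme `K(L) ↪ A` is finite over `Spec R`

Layer `Literature/AlgebraicGeometry/AbelianSchemes`, namespace `Literature.AlgebraicGeometry.AbelianSchemes.AbelianSchemeOver`.
Cell `hodgecm-mathlib` (D-0151), F-DAG price sheet §5 (h5-C) «`K(L)` is FINITE over `S`» — THEOREMS ONLY (no definition, no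
instance, no notation, no named fact, no `sorry`); count-neutral capital (author B-p05 (g16)).  HC_CM is proved only modulo
the 7 printed citations until rung 0 closes; this file asserts nothing about HC.

## Mathematics

[MumfordAV1970] §13 / §6 Application 1: for `L` ample the group `K(L)` is finite.  Over a base: once `K(L) ⊆ A` is a
CLOSED subscheme `i : Z ↪ A` representing the functor `T ↦ K(L)(T)` (★ `AbelianSchemeKOfLSeesaw`), `Z → S` is proper
(closed in the proper `A → S`), and its geometric fibres are the finite sets `K(L)(κ̄) = K(Θ_s̄)` (★ `AbelianSchemeKOfLFibres`,
for `L|_{A_s̄}` of the class of an AMPLE divisor `Θ_s̄`); a proper morphism with finite geometric fibres is finite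
(★ `Morphisms.isFinite_of_isProper_of_finite_specOver`, Zariski's Main Theorem).

* `isProper_hom_of_isClosedImmersion` — `Z → S` is proper for `Z ↪ A` closed;
* `finite_specOver_of_iff_memKOfL` — the geometric points of `Z` over `s̄` inject into `K(L)(s̄)`, finite for `Θ_s̄` ample;
* **`isFinite_hom_of_iff_memKOfL`** — `Z → S` IS FINITE (any base `S`, any representing closed `Z ↪ A`, `L` fibrewise
  ample-represented);
* **`exists_isClosedImmersion_isFinite_iff_memKOfL`** — over `Spec R`, packaged with ★ `exists_isClosedImmersion_iff_memKOfL`: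
  `K(L)` is a closed subscheme of `A`, FINITE over `Spec R` (modulo the relative-seesaw inputs).
* (ed. 2) `exists_isClosedImmersion_isFinite_iff_memKOfL_of_univStein` — the same with `[GeometricallyIntegral A.X.hom]`
  discharged by ★ `geometricallyIntegral_hom_overBase`.

## References
* [MumfordAV1970] D. Mumford, *Abelian Varieties* (1970), §6 Application 1 (p. 60); §13 (p. 123).
* [GortzWedhorn2020] U. Görtz, T. Wedhorn, *Algebraic Geometry I*, 2nd ed. (2020), Cor. 12.89 (p. 363).
-/

noncomputable section

-- `Scheme.Modules` / `SheafOfModules` are not reducible; fibre spellings unfold by `rfl` only (as in ★ `AbelianSchemeKOfL*`).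
set_option backward.isDefEq.respectTransparency false

universe u

open CategoryTheory CategoryTheory.Limits AlgebraicGeometry MonoidalCategory CartesianMonoidalCategory

namespace Literature.AlgebraicGeometry.AbelianSchemes

open Literature.AlgebraicGeometry.Motives Literature.AlgebraicGeometry.AbelianVarieties
  Literature.AlgebraicGeometry.Modules Literature.AlgebraicGeometry.Morphisms

namespace AbelianSchemeOver

section AnyBase

variable {S : Scheme.{u}} (A : AbelianSchemeOver S) {Z : Over S} (i : Z ⟶ A.X)

/-- A closed subscheme `Z ↪ A` of an abelian scheme is PROPER over the base (`Z → S = (Z ↪ A) ∘ (A → S)`).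
[cite: MumfordFogartyKirwan1994, Ch. 6 §1 Definition 6.1 (p. 115)] -/
theorem isProper_hom_of_isClosedImmersion [IsClosedImmersion i.left] : IsProper Z.hom := by
  haveI := A.isProper
  rw [← Over.w i]
  infer_instance

/-- **The geometric points of `Z` over `s̄` are finite in number** when `Z ↪ A` represents `K(L)` and `L|_{A_s̄}` has the
class of an AMPLE divisor `Θ` (`Ω` algebraically closed): they inject (`i` is a monomorphism) into
`K(L)(s̄) ⊆ A_s̄(Ω)`, which is `K(Θ)`, finite ([MumfordAV1970] §6 Application 1; ★ `finite_setOf_memKOfL_fibrePoints`).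
[cite: MumfordAV1970, §6 Application 1 (p. 60) and §13 (p. 123)] -/
theorem finite_specOver_of_iff_memKOfL [IsClosedImmersion i.left] {L : A.left.Modules} (hL : HasRank L 1)
    (hZ : ∀ (T : Over S) (u : T ⟶ A.X), (∃ v : T ⟶ Z, v ≫ i = u) ↔ A.MemKOfL L u)
    {Ω : Type u} [Field Ω] [IsAlgClosed Ω] (s : Spec (.of Ω) ⟶ S)
    {Θ : CartierDivisor (A.fibre s).toAbelianVariety.X.left} (hΘ : Θ.IsAmple)
    (hLΘ : CechPic.pullback (X := (A.fibre s).toAbelianVariety.X.left) (pullback.fst A.X.hom s)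
      (detClass (HasRank.isFiniteLocallyFree' hL)) = Θ.cechClass) :
    Finite {x : Spec (.of Ω) ⟶ Z.left // x ≫ Z.hom = s} := by
  haveI : Finite {u : A.FibrePoints s | A.MemKOfL L u} := (A.finite_setOf_memKOfL_fibrePoints s hL hΘ hLΘ).to_subtype
  refine Finite.of_injective (fun x : {x : Spec (.of Ω) ⟶ Z.left // x ≫ Z.hom = s} =>
    (⟨(Over.homMk x.1 x.2 : Over.mk s ⟶ Z) ≫ i, (hZ _ _).1 ⟨_, rfl⟩⟩ : {u : A.FibrePoints s | A.MemKOfL L u})) ?_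
  intro x x' h
  have h1 : (Over.homMk x.1 x.2 : Over.mk s ⟶ Z) ≫ i = (Over.homMk x'.1 x'.2 : Over.mk s ⟶ Z) ≫ i :=
    congrArg Subtype.val h
  have h2 := (cancel_mono i.left).1 (show x.1 ≫ i.left = x'.1 ≫ i.left from congrArg CommaMorphism.left h1)
  exact Subtype.ext h2

/-- **`K(L) → S` IS FINITE**: a closed subscheme `Z ↪ A` representing `K(L)`, for `L` of rank one whose restriction to
every geometric fibre `A_s̄` has the class of an AMPLE divisor, is finite over `S` — proper (closed in `A`) with finite
geometric fibres (`finite_specOver_of_iff_memKOfL`), hence finite by Zariski's Main Theorem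
(★ `Morphisms.isFinite_of_isProper_of_finite_specOver`). [cite: MumfordAV1970, §6 Application 1 (p. 60) and §13 (p. 123)]
[cite: GortzWedhorn2020, Cor. 12.89 (p. 363)] -/
theorem isFinite_hom_of_iff_memKOfL [IsClosedImmersion i.left] {L : A.left.Modules} (hL : HasRank L 1)
    (hZ : ∀ (T : Over S) (u : T ⟶ A.X), (∃ v : T ⟶ Z, v ≫ i = u) ↔ A.MemKOfL L u)
    (hΘ : ∀ ⦃Ω : Type u⦄ [Field Ω] [IsAlgClosed Ω] (s : Spec (.of Ω) ⟶ S),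
      ∃ Θ : CartierDivisor (A.fibre s).toAbelianVariety.X.left, Θ.IsAmple ∧
        CechPic.pullback (X := (A.fibre s).toAbelianVariety.X.left) (pullback.fst A.X.hom s)
          (detClass (HasRank.isFiniteLocallyFree' hL)) = Θ.cechClass) :
    IsFinite Z.hom := by
  haveI := A.isProper_hom_of_isClosedImmersion i
  refine isFinite_of_isProper_of_finite_specOver Z.hom fun y => ?_
  obtain ⟨Θ, hΘa, hLΘ⟩ := hΘ (Spec.map (CommRingCat.ofHom (algebraMap (S.residueField y)
    (AlgebraicClosure (S.residueField y)))) ≫ S.fromSpecResidueField y)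
  exact A.finite_specOver_of_iff_memKOfL i hL hZ _ hΘa hLΘ

end AnyBase

section AffineBase

open SeesawRelative

variable {R : Type} [CommRing R] (A : AbelianSchemeOver (Spec (.of R)))

/-- **`K(L)` is a closed subscheme of `A`, FINITE over `Spec R`** ([MumfordAV1970] §13 with §6 Application 1 and the
seesaw theorem of §10): for `A → Spec R` geometrically integral and universally Stein, `L` of rank one rigidified along the identity
section and fibrewise of the class of an ample divisor, and GIVEN the relative-seesaw representabilities `hX` of the family
`(p₂ : A ×_R A → A, Λ(L))` (★ `exists_isClosedImmersion_iff_memKOfL`), there is a closed immersion `i : Z ↪ A` over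
`Spec R` representing `K(L)` with `Z → Spec R` FINITE. [cite: MumfordAV1970, §6 Application 1 (p. 60) and §13 (p. 123)]
[cite: GortzWedhorn2020, Cor. 12.89 (p. 363)] [cite: GortzWedhorn2023, Thm. 24.66 (p. 405; proof pp. 407–408)] -/
theorem exists_isClosedImmersion_isFinite_iff_memKOfL [GeometricallyIntegral A.X.hom] (hSt : UnivStein A.X)
    {L : A.left.Modules} (hL : HasRank L 1)
    (hε : CechPic.pullback A.unitSection (detClass (HasRank.isFiniteLocallyFree' hL)) = 1)
    (hX : ∀ U : A.X.left.affineOpens,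
      H0Repr A.X (A.mumfordBundle L) U ∧ DualRepr A.X (A.mumfordBundle L) U (A.hasRank_mumfordBundle hL))
    (hΘ : ∀ ⦃Ω : Type⦄ [Field Ω] [IsAlgClosed Ω] (s : Spec (.of Ω) ⟶ Spec (.of R)),
      ∃ Θ : CartierDivisor (A.fibre s).toAbelianVariety.X.left, Θ.IsAmple ∧
        CechPic.pullback (X := (A.fibre s).toAbelianVariety.X.left) (pullback.fst A.X.hom s)
          (detClass (HasRank.isFiniteLocallyFree' hL)) = Θ.cechClass) :
    ∃ (Z : Over (Spec (.of R))) (i : Z ⟶ A.X) (_ : IsClosedImmersion i.left) (_ : IsFinite Z.hom),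
      ∀ (T : Over (Spec (.of R))) (u : T ⟶ A.X), (∃ v : T ⟶ Z, v ≫ i = u) ↔ A.MemKOfL L u := by
  obtain ⟨Z, i, hi, hZ⟩ := A.exists_isClosedImmersion_iff_memKOfL hSt hL hε hX
  exact ⟨Z, i, hi, A.isFinite_hom_of_iff_memKOfL i hL hZ hΘ, hZ⟩

/-- **The same with the geometric-integrality hypothesis DISCHARGED** (★ `geometricallyIntegral_hom_overBase`: an abelian
scheme is geometrically integral over any base): over `Spec R`, for `A` universally Stein, `L` of rank one rigidified and
fibrewise ample-represented, and given the relative-seesaw representabilities `hX`, `K(L)` is a closed subscheme of `A`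
FINITE over `Spec R`. [cite: MumfordAV1970, §6 Application 1 (p. 60) and §13 (p. 123)] [cite: GortzWedhorn2020, Cor. 12.89 (p. 363)] -/
theorem exists_isClosedImmersion_isFinite_iff_memKOfL_of_univStein (hSt : UnivStein A.X)
    {L : A.left.Modules} (hL : HasRank L 1)
    (hε : CechPic.pullback A.unitSection (detClass (HasRank.isFiniteLocallyFree' hL)) = 1)
    (hX : ∀ U : A.X.left.affineOpens,
      H0Repr A.X (A.mumfordBundle L) U ∧ DualRepr A.X (A.mumfordBundle L) U (A.hasRank_mumfordBundle hL))
    (hΘ : ∀ ⦃Ω : Type⦄ [Field Ω] [IsAlgClosed Ω] (s : Spec (.of Ω) ⟶ Spec (.of R)),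
      ∃ Θ : CartierDivisor (A.fibre s).toAbelianVariety.X.left, Θ.IsAmple ∧
        CechPic.pullback (X := (A.fibre s).toAbelianVariety.X.left) (pullback.fst A.X.hom s)
          (detClass (HasRank.isFiniteLocallyFree' hL)) = Θ.cechClass) :
    ∃ (Z : Over (Spec (.of R))) (i : Z ⟶ A.X) (_ : IsClosedImmersion i.left) (_ : IsFinite Z.hom),
      ∀ (T : Over (Spec (.of R))) (u : T ⟶ A.X), (∃ v : T ⟶ Z, v ≫ i = u) ↔ A.MemKOfL L u :=
  haveI := A.geometricallyIntegral_hom_overBase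
  A.exists_isClosedImmersion_isFinite_iff_memKOfL hSt hL hε hX hΘ

end AffineBase

end AbelianSchemeOver

end Literature.AlgebraicGeometry.AbelianSchemes

end
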